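import Literature.Analysis.SegalBargmann.SchwartzTorusIdentification
import Literature.Analysis.SegalBargmann.HermiteBlockOperators
import Literature.Analysis.SegalBargmann.FockKFinite
import HarnessLib

/-!
# The Heisenberg-covariant compact group on `𝓢(ℝⁿ)` IS the block action of `U(n)` on the Hermite expansion (Folland 1989, Prop. (4.39), Ch. 4 §5)

Topic `Analysis/SegalBargmann`; namespace `Literature.Analysis.SegalBargmann`.  Sequel of `SchwartzTorusIdentification`
(torus case) to the whole compact group `U(σ)`: the unitary action `μ₀(U) = B⁻¹ ν₀(U) B` on `L²(ℝ^σ)` (`schrodingerU`,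
Folland Prop. (4.39)) preserves the degree blocks `span {h_β : |β| = d}` (Folland Ch. 4 §5, tree
`homogeneousSpan_invariant`), so its Hermite-basis matrix `uKernel U α β := ⟪h_α, μ₀(U) h_β⟫` is a DEGREE-BLOCK KERNEL
with unimodular blocks and continuous entries, and the block-operator file `HermiteBlockOperators` puts `μ₀(U)` on `𝓢`:

* §1 finite expansions in an orthonormal family; **`schrodingerU_hermiteL2_eq_sum : μ₀(U) h_β = Σ_{|α| ≤ |β|} uKernel U α β
  • h_α`** (`uKernel_eq_zero_of_degree_ne`: only `|α| = |β|` contributes);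
* §2 the kernel: `isBlockKernel_uKernel : IsBlockKernel (uKernel U) 0 1`, `continuous_uKernel`, `uKernel_one/_diagHom`;
* §3 **`unitaryOpPi U : 𝓢(ℝ^σ, ℂ) →L[ℂ] 𝓢(ℝ^σ, ℂ)`** with **`toL2 (unitaryOpPi U f) = schrodingerU U (toL2 f)`** (`μ₀(U)`
  PRESERVES `𝓢`; `liftsTo_unitaryOpPi`), the group law on `𝓢` (`unitaryOpPi_one/_mul`) and the junction with the torus
  file (`unitaryOpPi_diagHom_torusPt : unitaryOpPi (diag (torusPt θ)) = torusOpPi θ`);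
* §4 **RIGIDITY ON `𝓢`, compact form**: for ANY Schwartz-level family `ωS` Heisenberg-covariant over `ι : H → U(σ)`
  with unitary lifts, `ωS h f = vacCoeff ω h • unitaryOpPi (ι h) f` for EVERY `h` and EVERY `f ∈ 𝓢(ℝ^σ)`
  (`IsRhoCovariantS.apply_eq_vacCoeff_smul_unitaryOpPi`, Euclidean form `IsRhoCovariantSD.…_unitaryOpE`); vacuum
  calibration `ωS h h_0 = vacCoeff ω h • h_0` (`vacL2_eq_hermiteL2_zero`, `IsRhoCovariantS.apply_hermitePi_zero`);
* §5 STRONG CONTINUITY of `U ↦ unitaryOpPi U f` and `(U, f) ↦ unitaryOpPi U f` into `𝓢` (S2's Tannery argument), hence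
  **continuous orbit maps `h ↦ ωS h f` in the SCHWARTZ topology** for every covariant family with continuous `ι` and
  continuous vacuum expectation (`IsRhoCovariantS.continuous_apply/_uncurry`) — the compact half of the smooth-vector
  continuity of an archimedean Weil representation typed on `𝓢`.

Everything is proved from Mathlib and the imported tree files; no cited statement is used as a hypothesis.

## References

* [Folland1989] G. B. Folland, *Harmonic Analysis in Phase Space*, Annals of Mathematics Studies 122, Princeton UP
  (1989), §1.7, §4.2 (4.23) and the Schur remark following it, Prop. (4.39), Ch. 4 §5 ("each `𝓟_k` is obviously
  invariant").  [cite: Folland1989, Prop (4.39)]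

## Provenance

LEAN-IN-TREE rule (2026-08-18), pub-hodgecm model-construction sub-cell, seat mc-binder-2 gen 2 (binder rows A12/A34:
the compact-group clause of `omg_ins` at an archimedean place; W5-F6 `hinf` on the compact directions).
-/

set_option autoImplicit false

noncomputable section

open MeasureTheory Complex SchwartzMap Filter Topology
open scoped InnerProductSpace ComplexConjugate Real BigOperators

namespace Literature.Analysis.SegalBargmann

variable {σ : Type*} [Fintype σ] [DecidableEq σ]

local notation "L2R" σ => Lp ℂ 2 (volume : Measure (σ → ℝ))
local notation "SR" σ => SchwartzMap (σ → ℝ) ℂ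
local notation "SE" σ => SchwartzMap (EuclideanSpace ℝ σ) ℂ

/-! ## §1  Finite expansions and the Hermite-basis expansion of `μ₀(U) h_β` -/

section Expansion

omit [Fintype σ] [DecidableEq σ] in
/-- **Finite expansion in an orthonormal family**: a vector in the span of `{v_i : i ∈ S}`, `S` finite, `v` orthonormal,
is `Σ_{i ∈ S} ⟪v_i, w⟫ v_i`. [folklore] -/
theorem eq_sum_inner_smul_of_mem_span {E : Type*} [NormedAddCommGroup E] [InnerProductSpace ℂ E] {ι : Type*}
    [DecidableEq ι] {v : ι → E} (hv : Orthonormal ℂ v) (S : Finset ι) {w : E}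
    (hw : w ∈ Submodule.span ℂ (v '' (S : Set ι))) : w = ∑ i ∈ S, ⟪v i, w⟫_ℂ • v i := by
  induction hw using Submodule.span_induction with
  | mem x hx =>
    obtain ⟨j, hj, rfl⟩ := hx
    simp_rw [orthonormal_iff_ite.mp hv, ite_smul, one_smul, zero_smul]
    rw [Finset.sum_ite_eq' S j, if_pos (Finset.mem_coe.mp hj)]
  | zero => simp
  | add x y _ _ hx hy =>
    simp_rw [inner_add_right, add_smul, Finset.sum_add_distrib]
    rw [← hx, ← hy]
  | smul a x _ hx =>
    simp_rw [inner_smul_right, mul_smul, ← Finset.smul_sum]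
    rw [← hx]

/-- **The Hermite-basis matrix of the compact metaplectic action** `μ₀(U)` on `L²(ℝ^σ)`:
`uKernel U α β := ⟪h_α, μ₀(U) h_β⟫`. [cite: Folland1989, Prop (4.39)] -/
def uKernel (U : Matrix.unitaryGroup σ ℂ) (α β : σ →₀ ℕ) : ℂ :=
  ⟪(hermiteL2 α : L2R σ), schrodingerU U (hermiteL2 β)⟫_ℂ

/-- The finite block of multi-indices of degree exactly `d`, as a subset of `degLE d`. [folklore] -/
def degEq (d : ℕ) : Finset (σ →₀ ℕ) := (degLE d).filter fun α => α.degree = d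

omit [DecidableEq σ] in
/-- Membership in `degEq d`. [folklore] -/
theorem mem_degEq {d : ℕ} {α : σ →₀ ℕ} : α ∈ (degEq d : Finset (σ →₀ ℕ)) ↔ α.degree = d := by
  rw [degEq, Finset.mem_filter, mem_degLE_iff_degree_le]
  exact ⟨fun h => h.2, fun h => ⟨h.le, h⟩⟩

omit [DecidableEq σ] in
/-- `degEq d` is Folland's index set `{α : |α| = d}` of `𝓟_d`. [folklore] -/
theorem coe_degEq (d : ℕ) : ((degEq d : Finset (σ →₀ ℕ)) : Set (σ →₀ ℕ)) = {α | mdeg α ∈ ({d} : Set ℕ)} := by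
  ext α
  rw [Finset.mem_coe, mem_degEq, Set.mem_setOf_eq, Set.mem_singleton_iff, degree_eq_mdeg]

/-- **Degree preservation in the Fock model**: `ν₀(U) (ζ_β e^{−π|z|²/2})` lies in the span of the basis vectors of the
same degree (tree `homogeneousSpan_invariant`, Folland Ch. 4 §5). [cite: Folland1989, Prop (4.39)] -/
theorem fockRep_fockVec_mem_span (U : Matrix.unitaryGroup σ ℂ) (β : σ →₀ ℕ) :
    fockRep U (fockVec β) ∈ Submodule.span ℂ
      ((fun α : σ →₀ ℕ => (fockBasis α : FockL2 σ)) '' ((degEq β.degree : Finset (σ →₀ ℕ)) : Set (σ →₀ ℕ))) := by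
  rw [coe_degEq]
  refine homogeneousSpan_invariant β.degree U (Submodule.subset_span ⟨β, ?_, fockBasis_apply β⟩)
  rw [Set.mem_setOf_eq, Set.mem_singleton_iff, degree_eq_mdeg]

/-- **Fock-side expansion**: `ν₀(U) ζ_β = Σ_{|α| = |β|} ⟪ζ_α, ν₀(U) ζ_β⟫ ζ_α` (weights included). [cite: Folland1989, Prop (4.39)] -/
theorem fockRep_fockVec_eq_sum (U : Matrix.unitaryGroup σ ℂ) (β : σ →₀ ℕ) :
    fockRep U (fockVec β) =
      ∑ α ∈ degEq β.degree, ⟪(fockVec α : FockL2 σ), fockRep U (fockVec β)⟫_ℂ • fockVec α := by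
  have h := eq_sum_inner_smul_of_mem_span (fockBasis (σ := σ)).orthonormal (degEq β.degree)
    (fockRep_fockVec_mem_span U β)
  simpa only [fockBasis_apply] using h

/-- The Fock-side and the Schrödinger-side matrix entries agree (the Bargmann transform is unitary):
`⟪ζ_α, ν₀(U) ζ_β⟫ = uKernel U α β`. [cite: Folland1989, Prop (4.39)] -/
theorem inner_fockVec_fockRep_fockVec (U : Matrix.unitaryGroup σ ℂ) (α β : σ →₀ ℕ) :
    ⟪(fockVec α : FockL2 σ), fockRep U (fockVec β)⟫_ℂ = uKernel U α β := by
  rw [uKernel, schrodingerU_apply, bargmann_hermiteL2, ← bargmann_hermiteL2 α,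
    ← LinearIsometryEquiv.inner_map_map bargmann.symm, LinearIsometryEquiv.symm_apply_apply]

/-- **The Hermite-basis expansion of `μ₀(U) h_β`** over the block of `β`:
`μ₀(U) h_β = Σ_{|α| = |β|} uKernel U α β • h_α`. [cite: Folland1989, Prop (4.39)] -/
theorem schrodingerU_hermiteL2_eq_sum_degEq (U : Matrix.unitaryGroup σ ℂ) (β : σ →₀ ℕ) :
    schrodingerU U (hermiteL2 β : L2R σ) = ∑ α ∈ degEq β.degree, uKernel U α β • hermiteL2 α := by
  rw [schrodingerU_apply, bargmann_hermiteL2, fockRep_fockVec_eq_sum, map_sum]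
  refine Finset.sum_congr rfl fun α _ => ?_
  rw [map_smul, bargmann_symm_fockVec, inner_fockVec_fockRep_fockVec]

/-- **Off the block the matrix entry vanishes**: `uKernel U α β = 0` if `|α| ≠ |β|`. [cite: Folland1989, Prop (4.39)] -/
theorem uKernel_eq_zero_of_degree_ne (U : Matrix.unitaryGroup σ ℂ) {α β : σ →₀ ℕ} (h : α.degree ≠ β.degree) :
    uKernel U α β = 0 := by
  rw [uKernel, schrodingerU_hermiteL2_eq_sum_degEq, inner_sum]
  refine Finset.sum_eq_zero fun γ hγ => ?_
  rw [inner_smul_right, orthonormal_iff_ite.mp orthonormal_hermiteL2]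
  split_ifs with hαγ
  · exact absurd ((congrArg Finsupp.degree hαγ).trans (mem_degEq.mp hγ)) h
  · rw [mul_zero]

/-- The same expansion written over `degLE |β|` (the shape used by `hermiteBlockCLM_herm`):
`μ₀(U) h_β = Σ_{|α| ≤ |β|} uKernel U α β • h_α`. [cite: Folland1989, Prop (4.39)] -/
theorem schrodingerU_hermiteL2_eq_sum (U : Matrix.unitaryGroup σ ℂ) (β : σ →₀ ℕ) :
    schrodingerU U (hermiteL2 β : L2R σ) = ∑ α ∈ degLE β.degree, uKernel U α β • hermiteL2 α := by
  rw [schrodingerU_hermiteL2_eq_sum_degEq, degEq, Finset.sum_filter]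
  refine Finset.sum_congr rfl fun α _ => ?_
  split_ifs with h
  · rfl
  · rw [uKernel_eq_zero_of_degree_ne U h, zero_smul]

end Expansion

/-! ## §2  The kernel: block property, bound, continuity, torus value -/

section Kernel

/-- `‖uKernel U α β‖ ≤ 1` (Cauchy–Schwarz with unit vectors and a unitary). [folklore] -/
theorem norm_uKernel_le_one (U : Matrix.unitaryGroup σ ℂ) (α β : σ →₀ ℕ) : ‖uKernel U α β‖ ≤ 1 := by
  rw [uKernel]
  refine (norm_inner_le_norm _ _).trans ?_
  rw [LinearIsometryEquiv.norm_map, orthonormal_hermiteL2.norm_eq_one, orthonormal_hermiteL2.norm_eq_one, mul_one]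

/-- **`uKernel U` is a degree-block kernel with unimodular bound**: `IsBlockKernel (uKernel U) 0 1`.
[cite: Folland1989, Prop (4.39)] -/
theorem isBlockKernel_uKernel (U : Matrix.unitaryGroup σ ℂ) : IsBlockKernel (uKernel U) 0 1 where
  eq_zero α β h := uKernel_eq_zero_of_degree_ne U h
  norm_le α β := by
    rw [pow_zero, mul_one]
    exact norm_uKernel_le_one U α β

/-- **The matrix entries are continuous in `U`** (strong continuity of `μ₀`, tree `continuous_schrodingerU_apply`).
[folklore] -/
theorem continuous_uKernel (α β : σ →₀ ℕ) : Continuous fun U : Matrix.unitaryGroup σ ℂ => uKernel U α β :=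
  continuous_const.inner (continuous_schrodingerU_apply _)

/-- At the identity: `uKernel 1 α β = δ_{αβ}`. [folklore] -/
theorem uKernel_one (α β : σ →₀ ℕ) :
    uKernel (1 : Matrix.unitaryGroup σ ℂ) α β = if α = β then 1 else 0 := by
  rw [uKernel, schrodingerU_one, orthonormal_iff_ite.mp orthonormal_hermiteL2]

/-- **On the torus**: `uKernel (diag t) α β = δ_{αβ} · torusChar β t`. [folklore] -/
theorem uKernel_diagHom (t : σ → Circle) (α β : σ →₀ ℕ) :
    uKernel (diagHom t) α β = if α = β then torusChar β t else 0 := by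
  rw [uKernel, schrodingerU_diagHom_hermiteL2, inner_smul_right, orthonormal_iff_ite.mp orthonormal_hermiteL2]
  split_ifs <;> simp

end Kernel

/-! ## §3  `μ₀(U)` on the Schwartz space -/

section Operator

/-- **`μ₀(U)` on `𝓢(EuclideanSpace ℝ σ, ℂ)`**: the block operator of the kernel `uKernel U`. [cite: Folland1989, Prop (4.39)] -/
def unitaryOpE (U : Matrix.unitaryGroup σ ℂ) : (SE σ) →L[ℂ] SE σ :=
  hermiteBlockCLM (uKernel U) (isBlockKernel_uKernel U)

/-- **`μ₀(U)` on the Folland carrier `𝓢(ℝ^σ, ℂ)`**: `unitaryOpPi U := e^* ∘ unitaryOpE U ∘ (e^*)⁻¹`.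
[cite: Folland1989, Prop (4.39)] -/
def unitaryOpPi (U : Matrix.unitaryGroup σ ℂ) : (SR σ) →L[ℂ] SR σ :=
  (schwartzTransport (euclE σ) : (SE σ) →L[ℂ] SR σ).comp
    ((unitaryOpE U).comp ((schwartzTransport (euclE σ)).symm : (SR σ) →L[ℂ] SE σ))

/-- Unfolding. [folklore] -/
theorem unitaryOpPi_apply (U : Matrix.unitaryGroup σ ℂ) (f : SR σ) :
    unitaryOpPi U f = schwartzTransport (euclE σ) (unitaryOpE U ((schwartzTransport (euclE σ)).symm f)) := rfl

/-- `unitaryOpPi U = opTransport euclE (unitaryOpE U)`. [folklore] -/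
theorem coe_unitaryOpPi (U : Matrix.unitaryGroup σ ℂ) :
    (unitaryOpPi U : (SR σ) →ₗ[ℂ] SR σ) = opTransport (euclE σ) (unitaryOpE U : (SE σ) →ₗ[ℂ] SE σ) :=
  LinearMap.ext fun _ => rfl

/-- Action on the Hermite functions (Euclidean carrier): `unitaryOpE U h_β = Σ_{|α| ≤ |β|} uKernel U α β • h_α`.
[cite: Folland1989, Prop (4.39)] -/
theorem unitaryOpE_herm (U : Matrix.unitaryGroup σ ℂ) (β : σ →₀ ℕ) :
    unitaryOpE U (hermiteSchwartz (herm β)) = ∑ α ∈ degLE β.degree, uKernel U α β • hermiteSchwartz (herm α) :=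
  hermiteBlockCLM_herm (isBlockKernel_uKernel U) β

/-- Action on the Hermite functions (Folland carrier): `unitaryOpPi U h_β = Σ_{|α| ≤ |β|} uKernel U α β • h_α`.
[cite: Folland1989, Prop (4.39)] -/
theorem unitaryOpPi_hermitePi (U : Matrix.unitaryGroup σ ℂ) (β : σ →₀ ℕ) :
    unitaryOpPi U (hermitePi β) = ∑ α ∈ degLE β.degree, uKernel U α β • hermitePi α := by
  rw [unitaryOpPi_apply, schwartzTransport_symm_hermitePi, unitaryOpE_herm, map_sum]
  refine Finset.sum_congr rfl fun α _ => ?_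
  rw [map_smul, schwartzTransport_hermiteSchwartz]

/-- **`μ₀(U)` preserves `𝓢` and `unitaryOpPi U` is its restriction**: `toL2 (unitaryOpPi U f) = schrodingerU U (toL2 f)`
for every Schwartz `f` (both sides continuous linear in `f`, equal on the Hermite functions by
`schrodingerU_hermiteL2_eq_sum`). [cite: Folland1989, Prop (4.39)] -/
theorem toL2_unitaryOpPi (U : Matrix.unitaryGroup σ ℂ) (f : SR σ) :
    toL2 (unitaryOpPi U f) = schrodingerU U (toL2 f) := by
  have h : (toL2 : (SR σ) →L[ℂ] L2R σ).comp (unitaryOpPi U) =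
      (((schrodingerU U).toContinuousLinearEquiv : (L2R σ) ≃L[ℂ] L2R σ) : (L2R σ) →L[ℂ] L2R σ).comp toL2 :=
    clm_eq_of_eq_on_hermitePi fun β => by
      rw [ContinuousLinearMap.comp_apply, ContinuousLinearMap.comp_apply, unitaryOpPi_hermitePi, map_sum,
        ContinuousLinearEquiv.coe_coe, LinearIsometryEquiv.coe_toContinuousLinearEquiv, toL2_hermitePi,
        schrodingerU_hermiteL2_eq_sum]
      refine Finset.sum_congr rfl fun α _ => ?_
      rw [map_smul, toL2_hermitePi]
  have h2 := congrArg (fun R : (SR σ) →L[ℂ] L2R σ => R f) h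
  simpa only [ContinuousLinearMap.comp_apply, ContinuousLinearEquiv.coe_coe,
    LinearIsometryEquiv.coe_toContinuousLinearEquiv] using h2

/-- `LiftsTo` form of `toL2_unitaryOpPi`. [cite: Folland1989, Prop (4.39)] -/
theorem liftsTo_unitaryOpPi (U : Matrix.unitaryGroup σ ℂ) :
    LiftsTo (unitaryOpPi U : (SR σ) →ₗ[ℂ] SR σ)
      (((schrodingerU U).toContinuousLinearEquiv : (L2R σ) ≃L[ℂ] L2R σ) : (L2R σ) →L[ℂ] L2R σ) :=
  fun f => toL2_unitaryOpPi U f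

/-- **Group law on `𝓢`**, identity: `unitaryOpPi 1 = id` (by `toL2`-injectivity from `schrodingerU_one`). [folklore] -/
theorem unitaryOpPi_one : unitaryOpPi (1 : Matrix.unitaryGroup σ ℂ) = ContinuousLinearMap.id ℂ (SR σ) := by
  refine ContinuousLinearMap.ext fun f => toL2_injective ?_
  rw [toL2_unitaryOpPi, schrodingerU_one, ContinuousLinearMap.id_apply]

/-- **Group law on `𝓢`**, products: `unitaryOpPi (U V) = unitaryOpPi U ∘ unitaryOpPi V`. [folklore] -/
theorem unitaryOpPi_mul (U V : Matrix.unitaryGroup σ ℂ) :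
    unitaryOpPi (U * V) = (unitaryOpPi U).comp (unitaryOpPi V) := by
  refine ContinuousLinearMap.ext fun f => toL2_injective ?_
  rw [toL2_unitaryOpPi, schrodingerU_mul, ContinuousLinearMap.comp_apply, toL2_unitaryOpPi, toL2_unitaryOpPi]

/-- **Junction with the torus file**: on the torus the block operator IS the oscillator torus,
`unitaryOpPi (diag (torusPt θ)) = torusOpPi θ = e^{iθ·N}` (both lift to the same unitary). [cite: Folland1989, §1.7] -/
theorem unitaryOpPi_diagHom_torusPt (θ : σ → ℝ) : unitaryOpPi (diagHom (torusPt θ)) = torusOpPi θ := by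
  refine ContinuousLinearMap.ext fun f => toL2_injective ?_
  rw [toL2_unitaryOpPi, toL2_torusOpPi]

/-- The Euclidean-carrier `L²` form: `(toL2D (unitaryOpE U g)) ∘ euclE⁻¹ = μ₀(U) ((toL2D g) ∘ euclE⁻¹)`.
[cite: Folland1989, Prop (4.39)] -/
theorem l2Transport_toL2D_unitaryOpE (U : Matrix.unitaryGroup σ ℂ) (g : SE σ) :
    l2Transport (euclE σ) measurePreserving_euclE_symm (toL2D volume (unitaryOpE U g)) =
      schrodingerU U (l2Transport (euclE σ) measurePreserving_euclE_symm (toL2D volume g)) := by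
  rw [← toL2_schwartzTransport (euclE σ) measurePreserving_euclE_symm,
    ← toL2_schwartzTransport (euclE σ) measurePreserving_euclE_symm, ← toL2_unitaryOpPi, unitaryOpPi_apply,
    ContinuousLinearEquiv.symm_apply_apply]

end Operator

/-! ## §4  Rigidity on `𝓢`, compact form -/

section Rigidity

variable {H : Type*} {ι : H → Matrix.unitaryGroup σ ℂ} {ωS : H → ((SR σ) →ₗ[ℂ] SR σ)}
  {ω : H → ((L2R σ) ≃ₗᵢ[ℂ] L2R σ)}

/-- **Rigidity on Schwartz space, compact form.**  A family of linear operators on `𝓢(ℝ^σ)` that is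
Heisenberg-covariant over `ι : H → U(σ)` and lifts to unitaries `ω h` on `L²` IS `vacCoeff ω h • μ₀(ι h)` ON ALL OF
`𝓢(ℝ^σ)`: `ωS h f = vacCoeff ω h • unitaryOpPi (ι h) f` for every `h` and `f` (no Schwartz continuity of `ωS h` assumed;
the identity holds in `L²` by `IsRhoCovariantS.toL2_apply` + `toL2_unitaryOpPi`, and `toL2` is injective).
[cite: Folland1989, Prop (4.39)] -/
theorem IsRhoCovariantS.apply_eq_vacCoeff_smul_unitaryOpPi (hS : IsRhoCovariantS ι ωS)
    (hlift : ∀ h, LiftsTo (ωS h) (liftCLM ω h)) (h : H) (f : SR σ) :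
    ωS h f = vacCoeff ω h • unitaryOpPi (ι h) f := by
  apply toL2_injective
  rw [hS.toL2_apply hlift, map_smul, toL2_unitaryOpPi]

/-- On the Hermite functions: `ωS h (h_β) = vacCoeff ω h • Σ_{|α| ≤ |β|} uKernel (ι h) α β • h_α` — the `K`-types of
`ωS` are those of the polynomial Fock model shifted by the vacuum character. [cite: Folland1989, Prop (4.39)] -/
theorem IsRhoCovariantS.apply_hermitePi_eq_sum (hS : IsRhoCovariantS ι ωS)
    (hlift : ∀ h, LiftsTo (ωS h) (liftCLM ω h)) (h : H) (β : σ →₀ ℕ) :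
    ωS h (hermitePi β) = vacCoeff ω h • ∑ α ∈ degLE β.degree, uKernel (ι h) α β • hermitePi α := by
  rw [hS.apply_eq_vacCoeff_smul_unitaryOpPi hlift, unitaryOpPi_hermitePi]

/-- **Euclidean-carrier form**: a family `ωD` on `𝓢(EuclideanSpace ℝ σ, ℂ)` covariant over `ι` (`IsRhoCovariantSD euclE ι ωD`)
whose transports lift to unitaries satisfies `ωD h g = vacCoeff ω h • unitaryOpE (ι h) g` for every `g`.
[cite: Folland1989, Prop (4.39)] -/
theorem IsRhoCovariantSD.apply_eq_vacCoeff_smul_unitaryOpE {ωD : H → ((SE σ) →ₗ[ℂ] SE σ)}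
    (hD : IsRhoCovariantSD (euclE σ) ι ωD)
    (hlift : ∀ h, LiftsTo (opTransport (euclE σ) (ωD h)) (liftCLM ω h)) (h : H) (g : SE σ) :
    ωD h g = vacCoeff ω h • unitaryOpE (ι h) g := by
  have hS : IsRhoCovariantS ι (fun h => opTransport (euclE σ) (ωD h)) :=
    (isRhoCovariantS_opTransport_iff (euclE σ) ι ωD).2 hD
  have h1 := hS.apply_eq_vacCoeff_smul_unitaryOpPi hlift h (schwartzTransport (euclE σ) g)
  rw [opTransport_apply, ContinuousLinearEquiv.symm_apply_apply, unitaryOpPi_apply,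
    ContinuousLinearEquiv.symm_apply_apply, ← map_smul] at h1
  exact (schwartzTransport (euclE σ)).injective h1

/-- The vacuum of the rigidity lane IS the Gaussian Hermite vector: `k_0 = h_0` in `L²(ℝ^σ)` (`B k_0 = E_0 = ζ_0`).
[cite: Folland1989, §1.7] -/
theorem vacL2_eq_hermiteL2_zero : (vacL2 : L2R σ) = hermiteL2 0 :=
  bargmann.injective (by rw [bargmann_vacL2, cohVec_zero, fockBasis_apply, bargmann_hermiteL2])

/-- `toL2 (hermitePi 0) = k_0`. [cite: Folland1989, §1.7] -/
theorem toL2_hermitePi_zero : toL2 (hermitePi (0 : σ →₀ ℕ)) = (vacL2 : L2R σ) := by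
  rw [toL2_hermitePi, vacL2_eq_hermiteL2_zero]

/-- **Vacuum calibration ON `𝓢`**: the Gaussian `h_0 ∈ 𝓢(ℝ^σ)` is an eigenvector of EVERY covariant family, with
eigenvalue the vacuum expectation: `ωS h h_0 = vacCoeff ω h • h_0` — so the one datum left to the printed records
(the vacuum character) is read off in the Schwartz model directly. [cite: Folland1989, Prop (4.39)] -/
theorem IsRhoCovariantS.apply_hermitePi_zero (hS : IsRhoCovariantS ι ωS)
    (hlift : ∀ h, LiftsTo (ωS h) (liftCLM ω h)) (h : H) :
    ωS h (hermitePi 0) = vacCoeff ω h • hermitePi 0 := by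
  apply toL2_injective
  rw [hS.toL2_apply hlift, map_smul, toL2_hermitePi_zero, schrodingerU_vacL2]

end Rigidity

/-! ## §5  Strong continuity on the compact group -/

section Continuity

/-- **Strong continuity of `μ₀` on `𝓢(EuclideanSpace ℝ σ, ℂ)`**: `U ↦ unitaryOpE U g` is continuous into the Schwartz
topology (S2 `continuous_hermiteBlockCLM_apply` with the continuous unimodular kernels `uKernel`). [cite: Folland1989, Prop (4.39)] -/
theorem continuous_unitaryOpE_apply (g : SE σ) : Continuous fun U : Matrix.unitaryGroup σ ℂ => unitaryOpE U g :=
  continuous_hermiteBlockCLM_apply (ut := fun U : Matrix.unitaryGroup σ ℂ => uKernel U) isBlockKernel_uKernel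
    continuous_uKernel g

/-- Joint continuity `(U, g) ↦ unitaryOpE U g`. [cite: Folland1989, Prop (4.39)] -/
theorem continuous_unitaryOpE_uncurry :
    Continuous fun p : Matrix.unitaryGroup σ ℂ × (SE σ) => unitaryOpE p.1 p.2 :=
  continuous_hermiteBlockCLM_uncurry (ut := fun U : Matrix.unitaryGroup σ ℂ => uKernel U) isBlockKernel_uKernel
    continuous_uKernel

/-- **Strong continuity of `μ₀` on the Folland carrier**: `U ↦ unitaryOpPi U f` is continuous into `𝓢(ℝ^σ, ℂ)`.
[cite: Folland1989, Prop (4.39)] -/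
theorem continuous_unitaryOpPi_apply (f : SR σ) : Continuous fun U : Matrix.unitaryGroup σ ℂ => unitaryOpPi U f :=
  (schwartzTransport (euclE σ)).continuous.comp (continuous_unitaryOpE_apply ((schwartzTransport (euclE σ)).symm f))

/-- Joint continuity `(U, f) ↦ unitaryOpPi U f` on the Folland carrier. [cite: Folland1989, Prop (4.39)] -/
theorem continuous_unitaryOpPi_uncurry :
    Continuous fun p : Matrix.unitaryGroup σ ℂ × (SR σ) => unitaryOpPi p.1 p.2 := by
  have h1 : Continuous fun p : Matrix.unitaryGroup σ ℂ × (SR σ) => (p.1, (schwartzTransport (euclE σ)).symm p.2) :=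
    continuous_fst.prodMk ((schwartzTransport (euclE σ)).symm.continuous.comp continuous_snd)
  have h2 : Continuous fun p : Matrix.unitaryGroup σ ℂ × (SR σ) =>
      unitaryOpE p.1 ((schwartzTransport (euclE σ)).symm p.2) :=
    continuous_unitaryOpE_uncurry.comp
      (f := fun p : Matrix.unitaryGroup σ ℂ × (SR σ) => (p.1, (schwartzTransport (euclE σ)).symm p.2)) h1
  have h3 : Continuous fun p : Matrix.unitaryGroup σ ℂ × (SR σ) =>
      schwartzTransport (euclE σ) (unitaryOpE p.1 ((schwartzTransport (euclE σ)).symm p.2)) :=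
    (schwartzTransport (euclE σ)).continuous.comp
      (f := fun p : Matrix.unitaryGroup σ ℂ × (SR σ) => unitaryOpE p.1 ((schwartzTransport (euclE σ)).symm p.2)) h2
  simpa only [unitaryOpPi_apply] using h3

variable {H : Type*} [TopologicalSpace H] {ι : H → Matrix.unitaryGroup σ ℂ} {ωS : H → ((SR σ) →ₗ[ℂ] SR σ)}
  {ω : H → ((L2R σ) ≃ₗᵢ[ℂ] L2R σ)}

/-- **Orbit maps of a covariant Schwartz-level family are continuous in the SCHWARTZ topology** as soon as `ι` and the
vacuum expectation `h ↦ ⟨k_0, ω(h) k_0⟩` are continuous: `h ↦ ωS h f` is continuous for every `f ∈ 𝓢(ℝ^σ)`.  (The vacuum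
expectation is continuous e.g. when `h ↦ ω h k_0` is, `continuous_vacCoeff`.) [cite: Folland1989, Prop (4.39)] -/
theorem IsRhoCovariantS.continuous_apply (hS : IsRhoCovariantS ι ωS) (hlift : ∀ h, LiftsTo (ωS h) (liftCLM ω h))
    (hι : Continuous ι) (hvac : Continuous (vacCoeff ω)) (f : SR σ) : Continuous fun h => ωS h f := by
  have h1 : (fun h => ωS h f) = fun h => vacCoeff ω h • unitaryOpPi (ι h) f :=
    funext fun h => hS.apply_eq_vacCoeff_smul_unitaryOpPi hlift h f
  rw [h1]
  exact hvac.smul ((continuous_unitaryOpPi_apply f).comp hι)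

/-- **Joint continuity** `(h, f) ↦ ωS h f` on `H × 𝓢(ℝ^σ)` under the same hypotheses. [cite: Folland1989, Prop (4.39)] -/
theorem IsRhoCovariantS.continuous_uncurry (hS : IsRhoCovariantS ι ωS) (hlift : ∀ h, LiftsTo (ωS h) (liftCLM ω h))
    (hι : Continuous ι) (hvac : Continuous (vacCoeff ω)) : Continuous fun p : H × (SR σ) => ωS p.1 p.2 := by
  have h1 : (fun p : H × (SR σ) => ωS p.1 p.2) = fun p => vacCoeff ω p.1 • unitaryOpPi (ι p.1) p.2 :=
    funext fun p => hS.apply_eq_vacCoeff_smul_unitaryOpPi hlift p.1 p.2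
  rw [h1]
  have h2 : Continuous fun p : H × (SR σ) => (ι p.1, p.2) := (hι.comp continuous_fst).prodMk continuous_snd
  exact (hvac.comp continuous_fst).smul
    (continuous_unitaryOpPi_uncurry.comp (f := fun p : H × (SR σ) => (ι p.1, p.2)) h2)

end Continuity

end Literature.Analysis.SegalBargmann
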